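import Summits.QuantumFields.BalabanUV.Beta.D1BFx.RWeightedLegPackReadout

/-!
# Road «BF-x» — slot (K), N-SIDE OF (A1) IN THE ROAD's `hessKer` CURRENCY («NLEG-HESS-SPLIT»): the one-loop kernel over the packed R-weighted
# N-leg `NlegK n Ga Cm a′ = pack(½Γ_R, ℋ_R, ℋ♭_R, 2(a′δ − Cm))` SPLITS as «gluon word over the fine leg `½Ga`» + «sandwich cross words» + «block terms»,
# and at the road's legs its chain-rule vertex IS the typed chain-rule vertex `vertexOf`

WHY.  (A1) `KCombineCovStripped.hessKer_transfer_road_cov_stripped` delivers the dressed sharp one-shot kernel as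
`hessKer (NlegRoad m a) 𝒱N 𝒲N + 2·(comb-FP word) − (ghost tower)`, pointwise in `z`; the road's (K) row in pointwise currency
(`RoadEndBFxDictPointwiseS.hdict_of_pointwise`, row `hptw`) wants `ω_gl·TOfRed n a S W + ω_gh·PghQ + Σ_u Rk u` with `TOfRed n a S W = hessKer (Ga n a) (vertexRed n S) W`
(T8, `ReducedKernel`).  This file is the N-side half of that reading, [folklore] kernel bookkeeping over `PackedKernelSplit` (R2-a):
* §1 the ff block of the N-leg: `HRp_inl_inl = 0`, `HRbp_inl_inl = 0` (the mixed packs have no ff entries), **`blk_NlegK_tt`**: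
  `blk (NlegK n Ga Cm a′) true true = ½•Ga + (−½)•(blk (sandP n Ga Cm) true true)` — the fine leg `½Ga` plus the coarse-mediated sandwich `−½·Ga𝒬ᵀCm𝒬Ga`;
* §2 **`hessKer_NlegK_split`**: for a spread fine leg `Ga`, a spread coarse kernel `Cm` and localised packed vertex∕table families `V`, `W`,
  `hessKer (NlegK n Ga Cm a′) V W μ ν z = hessKer (½•Ga) V_ff W_ff μ ν z + legCross (½•Ga) ((−½)•sandwich_ff) V_ff W_ff μ ν z + blockTerms (NlegK n Ga Cm a′) V W μ ν z`
  (`hessKer_eq_ff_add_blockTerms` + `hessKer_add_leg`) — the 3 + 15 block words (every one with an `ℋ_R` or multiplier leg) and the 1 + 3 sandwich cross words are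
  the NAMED rest kernels of the N-side; road instance **`hessKer_NlegRoad_split`** (mod `Spr (Ga (m+1) a)`);
* §3 leg scaling of the one-loop kernel: `hessKer_smul_leg` (`hessKer (c•A) V W = ½c·tadpole − ½c²·bubble`), so the gluon word over `½Ga` is `¼·(½·tadpole Ga (2•W) − ½·bubble Ga V V)`;
* §4 AT THE ROAD's LEGS the chain-rule vertex through the N-leg's `ℋ_R`-column IS the typed one: **`vertexOfK_NlegRoad_eq_vertexOf`**
  `vertexOfK (NlegRoad m a) (m+1) S = vertexOf (N := m+1) S` modulo [B5] Prop. 1.2 ∧ (1.126)–(1.127) BY NAME (`RWeightedLegPackReadout.NlegRoad_inl_inr_coarse_eq_KInv`),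
  hence its ff part is T8's reduced vertex (`PackedKernelSplit.ffV_vertexOf`): `ffV (vertexOfK (NlegRoad m a) (m+1) S) = vertexRedF (m+1) (S·ff)`.

HONEST: [folklore]∕[our object] bookkeeping over the tree's `PackedKernelSplit`, `RWeightedLegPack*`, `TameKernelCalculus`; no `def`, nothing cited, 0 sorry; the
(A2-N) dictionary (WHICH tables `S`, `W` the N-jets of (A1) are) and every n-uniform estimate of the rest kernels are NOT here; 0 rows discharged; (K) NOT closed;
NOT D1, NOT `BetaPertH`, NOT continuum, NOT Clay.
HONEST DEPENDENCY: continuum YM on T⁴ ⇐ BetaPertH ∧ nine spine estimates (0/9 proved); BetaPertH ⇐ (D1) ∧ (D4) ∧ CAP+tail; G-an2-4 gates asym, D1 and NE2/3/4.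
-/

noncomputable section

open Finset
open scoped BigOperators
open Literature.MathematicalPhysics.QuantumFieldTheory.Balaban1983to89
open Literature.MathematicalPhysics.QuantumFieldTheory.Balaban1983to89.Beta
open ExpKernelCalculus (Site MKer Decays BiLoc comp tr tadpole bubble hessKer)
open OneStepResolventKernel (Fib KInv vertexOf)
open OneStepKernelFamily (vertexOfK colH vertexOfK_KInv)
open VectorTailsLoc (fam kfam)
open Summit.QuantumFields.BalabanUV.Beta.TameKernelCalculus (Spr Loc trK)
open Summit.QuantumFields.BalabanUV.Beta.D1BFx.PackedKernelSplit (blk packK ffV ffW biBubble legCross blockTerms blk_tt loc_blk spr_blk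
  hessKer_eq_ff_add_blockTerms hessKer_add_leg ffV_vertexOf)
open Summit.QuantumFields.BalabanUV.Beta.D1BFx.ReducedKernelF (vertexRedF)
open Summit.QuantumFields.BalabanUV.Beta.D1BFx.CoarseGramInverse (multM spr_multM)
open Summit.QuantumFields.BalabanUV.Beta.D1BFx.FrozenLegTails (nOf MOf hn1)

open Summit.QuantumFields.BalabanUV.Beta.D1BFx.RWeightedLegPack

namespace Summit.QuantumFields.BalabanUV.Beta.D1BFx.NlegKHessSplit

variable (n : ℕ)

/-! ## §1 The ff block of the N-leg -/

section FF

variable {Ga Cm : MKer 4 (Fin 4)}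

omit n in
/-- [folklore] A composition whose RIGHT factor has no field columns at `(w, l)` has none either. -/
theorem comp_inl_col_zero {A K : MKer 4 (Fib 3)} {w : Fin 4 → ℤ} {l : Fin 4} (hK : ∀ z f, K z w f (Sum.inl l) = 0)
    (x : Fin 4 → ℤ) (a : Fib 3) : comp A K x w a (Sum.inl l) = 0 := by
  simp only [ExpKernelCalculus.comp, hK, mul_zero, Finset.sum_const_zero, tsum_zero]

/-- [our object] `Cp` has no field columns. -/
theorem Cp_inl_col (z w : Fin 4 → ℤ) (f : Fib 3) (l : Fin 4) : Cp n Cm z w f (Sum.inl l) = 0 := by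
  cases f <;> rfl

/-- [our object] `Cp` has no field rows. -/
theorem Cp_inl_row (x z : Fin 4 → ℤ) (κ : Fin 4) (f : Fib 3) : Cp n Cm x z (Sum.inl κ) f = 0 := by
  cases f <;> rfl

/-- [folklore] `ℋ_R = Gp ∘ Qpᵀ ∘ Cp` has no ff entries (its right factor ends in `Cp`, which has no field columns). -/
theorem HRp_inl_inl (x w : Fin 4 → ℤ) (κ l : Fin 4) : HRp n Ga Cm x w (Sum.inl κ) (Sum.inl l) = 0 :=
  comp_inl_col_zero (comp_inl_col_zero (fun z f => Cp_inl_col n z w f l)) x _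

/-- [folklore] `ℋ♭_R = Cp ∘ Qp ∘ Gp` has no ff entries (its left factor `Cp` has no field rows). -/
theorem HRbp_inl_inl (x w : Fin 4 → ℤ) (κ l : Fin 4) : HRbp n Ga Cm x w (Sum.inl κ) (Sum.inl l) = 0 :=
  comp_inl_row_zero (fun z f => Cp_inl_row n x z κ f) w _

/-- [folklore] **THE ff BLOCK OF THE N-LEG**: `blk (NlegK n Ga Cm a′) true true = ½•Ga + (−½)•(Ga𝒬ᵀCm𝒬Ga)_ff` — the fine leg and the coarse-mediated
sandwich; the mixed packs `ℋ_R`, `ℋ♭_R` and the multiplier pack contribute nothing. -/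
theorem blk_NlegK_tt (a' : ℝ) :
    blk (NlegK n Ga Cm a') true true = (2 : ℝ)⁻¹ • Ga + (-(2 : ℝ)⁻¹) • blk (sandP n Ga Cm) true true := by
  funext x z a b
  simp only [blk_tt, NlegK, Pi.add_apply, Pi.sub_apply, Pi.smul_apply, smul_eq_mul, Gp_inl_inl, HRp_inl_inl, HRbp_inl_inl, Cp_inl_inl]
  ring

end FF

/-! ## §2 The split of the one-loop kernel over the N-leg -/

section Split

variable [NeZero n] {Ga Cm : MKer 4 (Fin 4)}

/-- [folklore] **«NLEG-HESS-SPLIT»**: for a spread fine leg `Ga`, a spread coarse kernel `Cm`, any mass `a′`, and packed vertex∕table families `V`, `W` with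
localised entries, the one-loop kernel over the N-leg splits, POINTWISE in the separation `z`, as
`hessKer (NlegK n Ga Cm a′) V W μ ν z = hessKer (½•Ga) V_ff W_ff μ ν z + legCross (½•Ga) ((−½)•sandwich_ff) V_ff W_ff μ ν z + blockTerms (NlegK n Ga Cm a′) V W μ ν z`:
the GLUON WORD over the fine leg, the SANDWICH CROSS WORDS (`PackedKernelSplit.legCross`: one tadpole and three bi-bubbles, each with ≥ 1 leg `Ga𝒬ᵀCm𝒬Ga`),
and the BLOCK TERMS (3 tadpoles + 15 bi-bubbles, each with ≥ 1 `ℋ_R`∕`ℋ♭_R`∕multiplier leg). -/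
theorem hessKer_NlegK_split (hGa : Spr Ga) (hCm : Spr Cm) (a' : ℝ)
    {V : Fin 4 → Site 4 → MKer 4 (Fib 3)} (hV : ∀ μ y, Loc (V μ y))
    {W : Fin 4 → Site 4 → Fin 4 → Site 4 → MKer 4 (Fib 3)} (hW : ∀ μ y ν y', Loc (W μ y ν y')) (μ ν : Fin 4) (z : Site 4) :
    hessKer (NlegK n Ga Cm a') V W μ ν z =
      hessKer ((2 : ℝ)⁻¹ • Ga) (ffV V) (ffW W) μ ν z
        + legCross ((2 : ℝ)⁻¹ • Ga) ((-(2 : ℝ)⁻¹) • blk (sandP n Ga Cm) true true) (ffV V) (ffW W) μ ν z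
        + blockTerms (NlegK n Ga Cm a') V W μ ν z := by
  have hffV : ∀ μ y, Loc (ffV V μ y) := fun μ y => loc_blk (hV μ y) true true
  have hffW : ∀ μ y ν y', Loc (ffW W μ y ν y') := fun μ y ν y' => loc_blk (hW μ y ν y') true true
  rw [hessKer_eq_ff_add_blockTerms (spr_NlegK n hGa hCm a') hV hW μ ν z, blk_NlegK_tt,
    hessKer_add_leg (spr_smul' _ hGa) (spr_smul' _ (spr_blk (spr_sandP n hGa hCm) true true)) hffV hffW μ ν z]

/-- [folklore] **THE ROAD INSTANCE** (block side `m + 1`, coupling `a`, MODULO `Spr (Ga (m+1) a)` — [B5] Prop. 1.2 ∧ (1.126)–(1.127) content by name elsewhere):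
`hessKer (NlegRoad m a) V W μ ν z = hessKer (½•Ga (m+1) a) V_ff W_ff μ ν z + legCross (½•Ga (m+1) a) ((−½)•sandwich_ff) V_ff W_ff μ ν z + blockTerms (NlegRoad m a) V W μ ν z`,
sandwich `= Ga𝒬ᵀCun′𝒬Ga` with `Cun′ = multM (m+1) (2a∕(m+1)⁸) 2`. -/
theorem hessKer_NlegRoad_split (m : ℕ) {a : ℝ} (hGa : Spr (GluonLeg.Ga (m + 1) a))
    {V : Fin 4 → Site 4 → MKer 4 (Fib 3)} (hV : ∀ μ y, Loc (V μ y))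
    {W : Fin 4 → Site 4 → Fin 4 → Site 4 → MKer 4 (Fib 3)} (hW : ∀ μ y ν y', Loc (W μ y ν y')) (μ ν : Fin 4) (z : Site 4) :
    hessKer (NlegRoad m a) V W μ ν z =
      hessKer ((2 : ℝ)⁻¹ • GluonLeg.Ga (m + 1) a) (ffV V) (ffW W) μ ν z
        + legCross ((2 : ℝ)⁻¹ • GluonLeg.Ga (m + 1) a)
            ((-(2 : ℝ)⁻¹) • blk (sandP (m + 1) (GluonLeg.Ga (m + 1) a) (multM (m + 1) (2 * a / ((m + 1 : ℕ) : ℝ) ^ 8) 2)) true true)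
            (ffV V) (ffW W) μ ν z
        + blockTerms (NlegRoad m a) V W μ ν z :=
  hessKer_NlegK_split (m + 1) hGa (spr_multM (m + 1) _ _) _ hV hW μ ν z

end Split

/-! ## §3 Leg scaling of the one-loop kernel -/

section Scaling

variable {D : ℕ} {F : Type*} [Fintype F]

omit n in
/-- [folklore] **LEG SCALING OF THE ONE-LOOP KERNEL**: the tadpole is linear and the bubble quadratic in the leg, so
`hessKer (c•A) V W μ ν z = ½c·tadpole A (W μ 0 ν z) − ½c²·bubble A (V μ 0) (V ν z)`; at `c = ½` the gluon word over `½Ga` is `¼·tadpole∕2 − ⅛·bubble`,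
i.e. `¼·hessKer Ga V (2•W)`. -/
theorem hessKer_smul_leg (c : ℝ) (A : MKer D F) (V : Fin D → Site D → MKer D F) (W : Fin D → Site D → Fin D → Site D → MKer D F)
    (μ ν : Fin D) (z : Site D) :
    hessKer (c • A) V W μ ν z = (1 / 2) * (c * tadpole A (W μ 0 ν z)) - (1 / 2) * (c ^ 2 * bubble A (V μ 0) (V ν z)) := by
  simp only [hessKer, ExpKernelCalculus.tadpole, ExpKernelCalculus.bubble]
  rw [KernelReflection.comp_smul_left c A (V μ 0), KernelReflection.comp_smul_left c A (V ν z), KernelReflection.comp_smul_left,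
    KernelReflection.comp_smul_left, KernelReflection.comp_smul_right, smul_smul, KernelReflection.tr_smul, KernelReflection.tr_smul, sq]

omit n in
/-- [folklore] The same, packaged: `hessKer (c•A) V W μ ν z = c²·hessKer A V (c⁻¹•W) μ ν z` for `c ≠ 0` (log-det scale invariance at one loop, table side). -/
theorem hessKer_smul_leg_eq (c : ℝ) (hc : c ≠ 0) (A : MKer D F) (V : Fin D → Site D → MKer D F)
    (W : Fin D → Site D → Fin D → Site D → MKer D F) (μ ν : Fin D) (z : Site D) :
    hessKer (c • A) V W μ ν z = c ^ 2 * hessKer A V (fun μ y ν y' => c⁻¹ • W μ y ν y') μ ν z := by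
  rw [hessKer_smul_leg]
  simp only [hessKer, ExpKernelCalculus.tadpole]
  rw [KernelReflection.comp_smul_right, KernelReflection.tr_smul]
  field_simp

end Scaling

/-! ## §4 At the road's legs: the N-side chain-rule vertex IS the typed chain-rule vertex -/

section Vertex

variable (m : ℕ) {a : ℝ} (ha : 0 < a)

/-- [folklore] **THE CHAIN-RULE VERTEX THROUGH THE N-LEG's `ℋ_R`-COLUMN IS THE TYPED ONE** — modulo [B5] Prop. 1.2 ∧ (1.126)–(1.127) BY NAME (the road's
standing `h12 ∧ h126`): `vertexOfK (NlegRoad m a) (m+1) S μ y = vertexOf (N := m+1) S μ y` for EVERY stencil family `S` (the weights are the fm entries at coarse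
columns, `RWeightedLegPackReadout.NlegRoad_inl_inr_coarse_eq_KInv`, then `OneStepKernelFamily.vertexOfK_KInv`). -/
theorem vertexOfK_NlegRoad_eq_vertexOf (h12 : B5.Prop12Printed (fam nOf hn1 MOf a ha)) (h126 : B5.Kernel126_127Printed (kfam nOf MOf))
    (S : Fin 4 → (Fin 4 → ℤ) → MKer 4 (Fib 3)) (μ : Fin 4) (y : Fin 4 → ℤ) :
    vertexOfK (NlegRoad m a) (m + 1) S μ y = vertexOf (N := m + 1) S μ y := by
  rw [← vertexOfK_KInv (N := m + 1) S μ y]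
  funext x z b c
  simp only [vertexOfK]
  refine Finset.sum_congr rfl fun κ' _ => ?_
  have hw : colH (NlegRoad m a) (m + 1) μ y κ' = colH (KInv (N := m + 1) (d := 3)) (m + 1) μ y κ' := by
    funext u
    simp only [colH]
    exact NlegRoad_inl_inr_coarse_eq_KInv m ha h12 h126 u y κ' μ
  rw [hw]

/-- [folklore] … hence ITS ff PART IS T8's REDUCED VERTEX of the ff stencils (`PackedKernelSplit.ffV_vertexOf`):
`ffV (vertexOfK (NlegRoad m a) (m+1) S) = vertexRedF (m+1) (S·ff)`. -/
theorem ffV_vertexOfK_NlegRoad (h12 : B5.Prop12Printed (fam nOf hn1 MOf a ha)) (h126 : B5.Kernel126_127Printed (kfam nOf MOf))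
    (S : Fin 4 → (Fin 4 → ℤ) → MKer 4 (Fib 3)) :
    ffV (vertexOfK (NlegRoad m a) (m + 1) S) = vertexRedF (m + 1) (fun κ u => blk (S κ u) true true) := by
  have h : vertexOfK (NlegRoad m a) (m + 1) S = vertexOf (N := m + 1) S :=
    funext fun μ => funext fun y => vertexOfK_NlegRoad_eq_vertexOf m ha h12 h126 S μ y
  rw [h]
  exact ffV_vertexOf (m + 1) S

end Vertex

end Summit.QuantumFields.BalabanUV.Beta.D1BFx.NlegKHessSplit

end
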